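import Summits.CriticalPhenomena.PercolationContinuityZ3.Theorems.PercNearOneGluingNoHeavyQuantBudgetFlow
import HarnessLib

/-!
# QUANT lane R8, T-DEC: THE LOW-CEILING CRITERION — a law whose positive low atoms all lie below `(T − y·M)/(1 − y)` is DEC at EVERY layer, with NO
# inequality on its masses (the budget criterion with the top as ceiling: the torque identity pays for everything); residual form toward `ResidDEC`
# (arm-1 gen 49, architect)

builds on p205010 (kernel theorem, internal audit signed; external expert review pending)

Support file (`--supports stmt-CriticalPhenomena-4575`), QUANT lane seat prim-quant-arm-1 (gen 49, architect), rung R8 of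
`run/shared/lean/prim/quant/LADDER.md`; memo `run/shared/lean/prim/quant/prim-quant-arm-1-g49/ARCH-G49.md` §5–§7.  Theorems only (no definitions), standard
axioms, no sorries.  Corollaries of `…QuantBudgetFlow` (`flowAtT_of_budget`: the first-moment budget criterion) and of the earlier certified regimes
(`decAt_resid_of_noLow`, arm-1 g49 part 5; `decAt_resid_of_regime`, arm-1 g48 part 4), all stated in the unfolded form of typer g41's target
`LawDec.ResidDECAt x a L` (`∀ j < ftop L, DECAt (a·x) j (ftop L) (resid a (wco a L) L)`, ✓ p421540, README V431's node of record at one list and one gate).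

THE LOW-CEILING CRITERION.  In the budget criterion take the ceiling `H = M` (the top): the budget inequality `Σ_{low l ≥ 1} μ(l)(T − l) ≤ Σ_{T < h ≤ M}
μ(h)(h − T)` is then AUTOMATIC — it is the torque identity `Σ_h μ(h)(h − T) = 0` with the zero atom's and the self-sufficient atoms' terms dropped
(`demand_le_budget_top`) — so the only hypothesis left is torque safety of the top for every charged positive low atom, `y·(M − l) ≤ T − l`, i.e.
**every positive low atom `l ≤ (T − y·M)/(1 − y)`** (**`decAt_all_of_lowCeiling`**).  This strictly contains the no-low criterion (`decAt_all_of_noLow`: no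
positive low atom at all) and needs no mass computation: only WHICH atoms are low.  Residual form: **`residDEC_of_lowCeiling`** — for tree-OK siblings
(`≥ 2`, `0 < a < 1`), if every charged positive low atom `l` of `R_a = resid a (wco a L) L` (`2l < a·fmean L`) satisfies `a·x·(ftop L − l) ≤ a·fmean L − l`,
i.e. `l·(1 − a·x) ≤ a·(fmean L − x·ftop L)` (the forest's top slack, `≥ 0`), then `R_a` is DEC at `a·x` at every layer.  E.g. census-2's witness
`(R¹[q](R²[s]))³` (one positive low atom `2` once `a·fmean > 4`): top slack `3q(1 − s)`, so the criterion reads `2(1 − aqs) ≤ 3aq(1 − s)`, i.e. `a·q·(3 − s) ≥ 2`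
(at `q = 19/20`, `s = 1/2`: `a ≥ .842`); the general budget criterion covers the rest of the band.

ALSO BY NAME (the certified regimes as instances of the node's target): **`residDEC_of_noLow`** (equal root gates, `a·fmean ≤ 4R`, sub-forests vanishing below
`R`), **`residDEC_of_regime`** (`a·fmean ≤ Smin`, or equal gates and `a·fmean ≤ 2·Smin`, under the oracle and the floor check) — both conclude
`∀ j < ftop L, DECAt (a·x) j (ftop L) (resid a (wco a L) L)`.

* `demand_le_budget_top` (torque identity ⟹ the budget inequality at ceiling `M`);
* **`decAt_all_of_lowCeiling`**, **`residDEC_of_lowCeiling`**, `residDEC_of_noLow`, `residDEC_of_regime`.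

HONEST STATUS: law-level / residual-level DEC criteria; `ResidDEC`, `SiblingStep`, `GateStepN`, `FarTreeRow` OPEN; RATE class log\* / honest sentence of
`run/shared/lean/prim/quant/README.md` unchanged.  [this work]; budget criterion: this seat; no-low / pair regimes: arm-1 g48/g49; node of record: lead g47 /
typer g41 / census-1 g24.  Nothing here is cited as a published result.  The gluing rows served [cite: KozmaNitzan2024, Conjecture 3 (p. 15)]; product measure
[cite: Grimmett1999, §1.3 p. 10].
-/

noncomputable section

open scoped BigOperators

namespace Summit.CriticalPhenomena.PercolationContinuityZ3.Theorems
namespace Quant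
namespace LawDec

open Finset

/-! ### The torque identity pays the demand when the ceiling is the top -/

/-- **the budget inequality at ceiling `M` is the torque identity**: for `μ ≥ 0` on `{0..M}` with `Σ h·μ h ≥ T·Σ μ h` (`T > 0`),
`Σ_{1 ≤ l, 2l < T} μ(l)(T − l) ≤ Σ_{T < h ≤ M} μ(h)(h − T)` (sums over `{0..M}`). [this work] -/
theorem demand_le_budget_top (M : ℕ) (μ : ℕ → ℝ) (T : ℝ) (hμ0 : ∀ h, 0 ≤ μ h)
    (hmom : T * ∑ h ∈ Finset.range (M + 1), μ h ≤ ∑ h ∈ Finset.range (M + 1), (h : ℝ) * μ h) :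
    ∑ l ∈ Finset.range (M + 1), (if (1 ≤ l ∧ 2 * (l : ℝ) < T) then μ l * (T - l) else 0)
      ≤ ∑ h ∈ Finset.range (M + 1), (if (T < (h : ℝ) ∧ h ≤ M) then μ h * ((h : ℝ) - T) else 0) := by
  have hpt : ∀ h ∈ Finset.range (M + 1),
      (if (1 ≤ h ∧ 2 * (h : ℝ) < T) then μ h * (T - h) else 0) - (if (T < (h : ℝ) ∧ h ≤ M) then μ h * ((h : ℝ) - T) else 0)
        ≤ (T - h) * μ h := by
    intro h hh
    have hhM : h ≤ M := by rw [Finset.mem_range] at hh; omega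
    have hμ := hμ0 h
    by_cases h1 : 1 ≤ h ∧ 2 * (h : ℝ) < T
    · have h2 : ¬ (T < (h : ℝ) ∧ h ≤ M) := fun hc => by linarith [hc.1, h1.2, (Nat.cast_nonneg h : (0 : ℝ) ≤ h)]
      rw [if_pos h1, if_neg h2]; linarith
    · rw [if_neg h1]
      by_cases h2 : T < (h : ℝ) ∧ h ≤ M
      · rw [if_pos h2]; linarith
      · rw [if_neg h2]
        have hTh : (h : ℝ) ≤ T := by
          by_contra hlt
          exact h2 ⟨not_le.1 hlt, hhM⟩
        nlinarith
  have hsum := Finset.sum_le_sum hpt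
  rw [Finset.sum_sub_distrib] at hsum
  have e : ∑ h ∈ Finset.range (M + 1), (T - h) * μ h
      = T * ∑ h ∈ Finset.range (M + 1), μ h - ∑ h ∈ Finset.range (M + 1), (h : ℝ) * μ h := by
    rw [Finset.mul_sum, ← Finset.sum_sub_distrib]
    exact Finset.sum_congr rfl fun h _ => by ring
  rw [e] at hsum
  linarith

/-! ### The low-ceiling criterion -/

/-- **THE LOW-CEILING CRITERION.**  A probability law `μ` on `{0..M}` with mean `T > 0`, floor `0 < y < 1`, `y·M ≤ T`, whose every charged positive low
atom `l` (`2l < T`) satisfies `y·(M − l) ≤ T − l` — i.e. `l ≤ (T − y·M)/(1 − y)` — is DEC at floor `y` at EVERY layer `j′ < M`.  No hypothesis on the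
masses (the budget criterion `flowAtT_of_budget` with the top as ceiling; the torque identity supplies the budget inequality). [this work] -/
theorem decAt_all_of_lowCeiling (y : ℝ) (M : ℕ) (μ : ℕ → ℝ) (T : ℝ) (hy0 : 0 < y) (hy1 : y < 1)
    (hμ0 : ∀ h, 0 ≤ μ h) (hμM : ∀ h, M < h → μ h = 0) (hμ1 : ∑ h ∈ Finset.range (M + 1), μ h = 1)
    (hT : ∑ h ∈ Finset.range (M + 1), (h : ℝ) * μ h = T) (hT0 : 0 < T) (hta : y * (M : ℝ) ≤ T)
    (hceil : ∀ l : ℕ, 1 ≤ l → 2 * (l : ℝ) < T → 0 < μ l → y * ((M : ℝ) - l) ≤ T - l) :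
    ∀ j', j' < M → DECAt y j' M μ := by
  intro j' hj'
  have hmom : T * ∑ h ∈ Finset.range (M + 1), μ h ≤ ∑ h ∈ Finset.range (M + 1), (h : ℝ) * μ h := by
    rw [hμ1, hT, mul_one]
  rw [decAt_iff_decAtT, hT]
  exact decAtT_of_flowAtT y T j' M μ hy0 hy1 hμM hμ1
    (flowAtT_of_budget y T j' M M μ hy0 hy1 hT0 hj' hμ0 hμM hta hmom hceil (demand_le_budget_top M μ T hμ0 hmom))

/-! ### Residual forms (the node's target `ResidDECAt x a L`, unfolded) -/

/-- **RESID-DEC FROM THE LOW CEILING.**  Tree-built siblings at floor `0 < x < 1` (at least two), `0 < a < 1`: if every charged positive low atom `l` of the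
residual `R_a = resid a (wco a L) L` (`2l < a·fmean L`) satisfies `a·x·(ftop L − l) ≤ a·fmean L − l` (equivalently `l·(1 − a x) ≤ a·(fmean L − x·ftop L)`),
then `R_a` is DEC at `a·x` at every layer below the top — `ResidDECAt x a L`. [this work] -/
theorem residDEC_of_lowCeiling {x a : ℝ} (hx0 : 0 < x) (hx1 : x < 1) (ha0 : 0 < a) (ha1 : a < 1) (L : List Sib)
    (hL : ∀ s ∈ L, s.TreeOK x) (hk : 2 ≤ L.length)
    (hceil : ∀ l : ℕ, 1 ≤ l → 2 * (l : ℝ) < a * fmean L → 0 < resid a (wco a L) L l →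
      (a * x) * ((ftop L : ℝ) - l) ≤ a * fmean L - l) :
    ∀ j, j < ftop L → DECAt (a * x) j (ftop L) (resid a (wco a L) L) := by
  have hL' : ∀ s ∈ L, s.LawOK := fun s hs => (hL s hs).lawOK
  have hne : L ≠ [] := by rintro rfl; simp at hk
  obtain ⟨s, t, L', rfl⟩ : ∃ s t L', L = s :: t :: L' := by
    rcases L with _ | ⟨s, _ | ⟨t, L'⟩⟩
    · exact absurd rfl hne
    · simp at hk
    · exact ⟨s, t, L', rfl⟩
  have hw1 : wco a (s :: t :: L') < 1 := wco_lt_one ha1 s t L' hL'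
  obtain ⟨r0, rM, r1, rmn⟩ := resid_laws ha0 ha1.le (s :: t :: L') hL' le_rfl hw1
  have hax0 : 0 < a * x := mul_pos ha0 hx0
  have hax1 : a * x < 1 := by nlinarith
  have hT0 : 0 < a * fmean (s :: t :: L') := mul_pos ha0 ((fmean_pos _ hL).2 hne)
  have hta : a * x * (ftop (s :: t :: L') : ℝ) ≤ a * fmean (s :: t :: L') := by
    rw [mul_assoc]
    exact mul_le_mul_of_nonneg_left (ftop_mul_floor_le_fmean hx0 hx1 _ hL) ha0.le
  exact decAt_all_of_lowCeiling (a * x) (ftop (s :: t :: L')) (resid a (wco a (s :: t :: L')) (s :: t :: L')) (a * fmean (s :: t :: L'))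
    hax0 hax1 r0 rM r1 rmn hT0 hta hceil

/-- **RESID-DEC IN THE NO-LOW REGIME** (arm-1 g49 `decAt_resid_of_noLow`, restated at the node's target): equal root gates, at least two tree-built siblings,
sub-forest laws vanishing below `R`, `0 < a < 1`, `a·fmean L ≤ 4R`. [this work] -/
theorem residDEC_of_noLow {x a q₀ : ℝ} (hx0 : 0 < x) (hx1 : x < 1) (ha0 : 0 < a) (ha1 : a < 1) (R : ℕ) (L : List Sib)
    (hL : ∀ s ∈ L, s.TreeOK x) (hk : 2 ≤ L.length) (hq : ∀ u ∈ L, u.q = q₀) (hR : ∀ s ∈ L, ∀ h, h < R → s.ρ h = 0)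
    (hreg : a * fmean L ≤ 4 * (R : ℝ)) :
    ∀ j, j < ftop L → DECAt (a * x) j (ftop L) (resid a (wco a L) L) := by
  have hL' : ∀ s ∈ L, s.LawOK := fun s hs => (hL s hs).lawOK
  have hne : L ≠ [] := by rintro rfl; simp at hk
  obtain ⟨s, t, L', rfl⟩ : ∃ s t L', L = s :: t :: L' := by
    rcases L with _ | ⟨s, _ | ⟨t, L'⟩⟩
    · exact absurd rfl hne
    · simp at hk
    · exact ⟨s, t, L', rfl⟩
  exact decAt_resid_of_noLow hx0 hx1 ha0 ha1.le R q₀ (s :: t :: L') hL hq hR (wco_lt_one ha1 s t L' hL') hreg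

/-- **RESID-DEC IN THE PAIR REGIME** (arm-1 g48 `decAt_resid_of_regime` at `w = wco a L`, restated at the node's target): at least two tree-built siblings under
the oracle, the uniform floor check, and `a·fmean L ≤ Smin L`, or equal root gates with `a·fmean L ≤ 2·Smin L`. [this work] -/
theorem residDEC_of_regime {x a : ℝ} (hx0 : 0 < x) (hx1 : x < 1) (ha0 : 0 < a) (ha1 : a < 1) (L : List Sib)
    (hL : ∀ s ∈ L, s.TreeOK x) (hk : 2 ≤ L.length)
    (hO : ∀ (x' : ℝ) (n' M' : ℕ) (μ' : ℕ → ℝ), n' < fgates L → TreeBuiltN x' n' M' μ' → SDEC x' M' μ')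
    (hfl : x * Stot L ≤ fmean L * xmin L)
    (hreg : a * fmean L ≤ Smin L ∨ ((∃ q₀ : ℝ, ∀ u ∈ L, u.q = q₀) ∧ a * fmean L ≤ 2 * Smin L)) :
    ∀ j, j < ftop L → DECAt (a * x) j (ftop L) (resid a (wco a L) L) := by
  have hL' : ∀ s ∈ L, s.LawOK := fun s hs => (hL s hs).lawOK
  have hne : L ≠ [] := by rintro rfl; simp at hk
  obtain ⟨s, t, L', rfl⟩ : ∃ s t L', L = s :: t :: L' := by
    rcases L with _ | ⟨s, _ | ⟨t, L'⟩⟩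
    · exact absurd rfl hne
    · simp at hk
    · exact ⟨s, t, L', rfl⟩
  have hw1 : wco a (s :: t :: L') < 1 := wco_lt_one ha1 s t L' hL'
  refine decAt_resid_of_regime hx0 hx1 ha0 ha1.le (s :: t :: L') hne hL hO le_rfl hw1 hfl ?_
  rcases hreg with h | ⟨hq, h⟩
  · exact Or.inl h
  · exact Or.inr ⟨hq, rfl, h⟩


end LawDec
end Quant
end Summit.CriticalPhenomena.PercolationContinuityZ3.Theorems
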